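import Summits.CriticalPhenomena.PercolationContinuityZ3.Theorems.PercNearOneGluingNoHeavyLowerTailAntitheticHandleDualShift
import Summits.CriticalPhenomena.PercolationContinuityZ3.Theorems.PercNearOneGluingNoHeavyLowerTailAntitheticTransportShift
import Summits.CriticalPhenomena.PercolationContinuityZ3.Theorems.PercNearOneGluingNoHeavyLowerTailAntitheticK24Shift
import HarnessLib

/-!
# `NoHeavyLowerTail` (stmt-CriticalPhenomena-4575) — antithetic cluster pairs: **THEOREM K24H — `K_{2,4}` PLUS A HANDLE FROM A POLE**
# (the vertex antithetic inequality at `R = {x}` / CONJECTURE Δ2 for `K_{2,4}` seen from a pole plus a handle from the other pole to ANY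
# vertex, ALL arm lengths; prim-hp-2 gen 67, HOME/MEMO-gen67.md §1)

Support file (`--supports stmt-CriticalPhenomena-4575`, hull-port prover `prim-hp-2`, gen 67).  No definitions, no named facts, no sorries;
COMPUTATIONAL only through its input …AntitheticK24Shift (kernel decisions by `native_decide`) and one `decide` over `Fin 6` here.

WHY THIS CORE.  `K_{2,4}` from a pole is the gadget on which the K-form currency of the handle method breaks: its ⊕-sum over the super-odd
class `𝒮` is `−3` for an explicit odd pair (…AntitheticK24NotOplus), so neither boxes nor pair-cube certificates nor the DUAL HANDLE THEOREM of
…AntitheticHandleDual can treat `K_{2,4} + handle`.  The SHIFTED-BIC class `𝒮_shift = {F⁺(X) − F⁻(Y) : F⁻ ≤ F⁺ monotone}` (what the degree-2 /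
pendant reductions actually produce; HOME/MEMO-gen65.md §2(d)) rescues it: the whole machinery was re-based on `𝒮_shift` (…Shift files, gen 65),
the reduced positivity statements were made DECIDABLE in the kernel (…AntitheticShiftDecide, gen 66), and …AntitheticK24Shift (gen 67) decides
(⊕)_shift of `(K24, s, c)` and (M)_shift of `(K24; c, c)`, `(K24; c, middle)`.  This file assembles:
* `Antithetic.K24.swap_invariant` — the middles are exchangeable (`E₁` is invariant under the transposition `(2 q)`, `q ∉ {0, 1}`);
* `Antithetic.K24.oplus_shift`, `Antithetic.K24.mixed_shift` — the two core hypotheses in COLOURING FORM on any `V` (transport along `c`,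
  …AntitheticTransportShift; the target `Q = c q` arbitrary: `q = 0` is the empty event, `q = 1` the pole, `q ≥ 2` a middle by symmetry);
* `Antithetic.K24.handle_vertex_sum_nonneg` — **THEOREM K24H**: `K_{2,4}` on `c 0 = s, c 1` (poles), `c 2, …, c 5` (middles), a handle
  `c 1 = u 0 – … – u a = y – x – z = w b – … – w 0 = c q` (any `q : Fin 6`, fresh arm vertices, `a, b ≥ 0`, `x` fresh, `yz ∉ H`): for all
  monotone `F, G`, `0 ≤ Σ_{ω : ¬(x ∈ X_E ω ∧ x ∈ Y_E ω)} (F(X_E ω) − F(Y_E ω))·(G(X_E ω) − G(Y_E ω))`, `E = K_{2,4} ∪ arms + xy + xz`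
  (edge set of `H` bracketed `(stub ∪ arm) ∪ E₀`).  Smallest new instances: `K_{2,4} + x` joined to the pole and a middle (`a = b = 0`,
  `q = 2`); `K_{2,5}` with one middle path subdivided (`q = 0`: a fifth `s – c` path through `x` of length `≥ 3`) — although `K_{2,5}` itself
  is not even BIC-⊕ from a pole (HOME/MEMO-gen58).
[cite: VandenbergHaggstromKahn2005, §1 p. 6 ("Harris' inequality"), §1 p. 3 (open cluster `C_s`)]
-/

noncomputable section

namespace Summit.CriticalPhenomena.PercolationContinuityZ3.Theorems

open Literature.Probability.Percolation
open scoped Classical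

namespace Antithetic

namespace K24

variable {V : Type*} {c : Fin 6 → V} (hc : Function.Injective c) {E₀ : Set (Sym2 V)}
  (hE₀ : E₀ = Sym2.map c '' ↑({s(0, 2), s(1, 2), s(0, 3), s(1, 3), s(0, 4), s(1, 4), s(0, 5), s(1, 5)} : Finset (Sym2 (Fin 6))))
include hc hE₀

omit hc hE₀ in
/-- The middles of `K_{2,4}` are exchangeable: `E₁` is invariant under the transposition of the middle `2` with any `q ∉ {0, 1}`.
[this work] -/
theorem swap_invariant : ∀ q : Fin 6, q ≠ 0 → q ≠ 1 →
    ({s(0, 2), s(1, 2), s(0, 3), s(1, 3), s(0, 4), s(1, 4), s(0, 5), s(1, 5)} : Finset (Sym2 (Fin 6))).image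
        (Sym2.map (Equiv.swap (2 : Fin 6) q)) =
      ({s(0, 2), s(1, 2), s(0, 3), s(1, 3), s(0, 4), s(1, 4), s(0, 5), s(1, 5)} : Finset (Sym2 (Fin 6))) := by
  decide

variable [Fintype V]

/-- **(⊕)_shift of `(K_{2,4}, pole, pole)` in colouring form** on any `V`. [this work] -/
theorem oplus_shift (Fp Fm Gp Gm : Set V → ℝ) (hFp : Monotone Fp) (hFm : Monotone Fm) (hF : ∀ S, Fm S ≤ Fp S)
    (hGp : Monotone Gp) (hGm : Monotone Gm) (hG : ∀ S, Gm S ≤ Gp S) :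
    0 ≤ ∑ T ∈ Finset.univ.filter (fun T : Set (Sym2 V) => c 1 ∈ openCluster (T ∩ E₀) (c 0)),
      (Fp (openCluster (T ∩ E₀) (c 0)) - Fm (openCluster (Tᶜ ∩ E₀) (c 0))) *
        (Gp (openCluster (T ∩ E₀) (c 0)) - Gm (openCluster (Tᶜ ∩ E₀) (c 0))) :=
  TransportShift.oplus_of_powerset hc _ 0 1
    (fun Lp Lm Mp Mm hLp hLm hL hMp hMm hM => by
      convert oplus_shift_powerset Lp Lm Mp Mm hLp hLm hL hMp hMm hM using 10)
    hE₀ Fp Fm Gp Gm hFp hFm hF hGp hGm hG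

/-- **(M)_shift of `(K_{2,4}; pole, c q)` in colouring form** on any `V`, for every `q : Fin 6` (`q = 0`: the event is empty; `q = 1`:
…K24Shift's pole statement; `q ≥ 2`: its middle statement transported along `c ∘ (2 q)`). [this work] -/
theorem mixed_shift (q : Fin 6) (Fp Fm Gp Gm : Set V → ℝ) (hFp : Monotone Fp) (hFm : Monotone Fm) (hF : ∀ S, Fm S ≤ Fp S)
    (hGp : Monotone Gp) (hGm : Monotone Gm) (hG : ∀ S, Gm S ≤ Gp S) :
    0 ≤ ∑ T ∈ Finset.univ.filter (fun T : Set (Sym2 V) =>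
        c 1 ∈ openCluster (T ∩ E₀) (c 0) ∧ c q ∉ openCluster (Tᶜ ∩ E₀) (c 0)),
      (Fp (openCluster (T ∩ E₀) (c 0)) - Fm (openCluster (Tᶜ ∩ E₀) (c 0))) *
        (Gp (openCluster (T ∩ E₀) (c 0)) - Gm (openCluster (Tᶜ ∩ E₀) (c 0))) := by
  by_cases hq0 : q = 0
  · subst hq0
    refine Finset.sum_nonneg fun T hT => ?_
    exact absurd (mem_openCluster_self _ _) (Finset.mem_filter.1 hT).2.2
  by_cases hq1 : q = 1
  · subst hq1
    exact TransportShift.mixed_of_powerset hc _ 0 1 1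
      (fun Lp Lm Mp Mm hLp hLm hL hMp hMm hM => by
        convert mixed_shift_pole_powerset Lp Lm Mp Mm hLp hLm hL hMp hMm hM using 10)
      hE₀ Fp Fm Gp Gm hFp hFm hF hGp hGm hG
  -- `q` a middle: relabel the middles by the transposition `σ = (2 q)`
  set σ : Equiv.Perm (Fin 6) := Equiv.swap (2 : Fin 6) q with hσ
  have hσ0 : σ 0 = 0 := Equiv.swap_apply_of_ne_of_ne (by decide) (Ne.symm hq0)
  have hσ1 : σ 1 = 1 := Equiv.swap_apply_of_ne_of_ne (by decide) (Ne.symm hq1)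
  have hσ2 : σ 2 = q := Equiv.swap_apply_left _ _
  have hc' : Function.Injective (c ∘ σ) := hc.comp σ.injective
  have hE₀' : E₀ = Sym2.map (c ∘ σ) ''
      ↑({s(0, 2), s(1, 2), s(0, 3), s(1, 3), s(0, 4), s(1, 4), s(0, 5), s(1, 5)} : Finset (Sym2 (Fin 6))) := by
    rw [hE₀, Sym2.map_comp, Set.image_comp]
    conv_rhs => rw [← Finset.coe_image, swap_invariant q hq0 hq1]
  have h := TransportShift.mixed_of_powerset hc' _ 0 1 2
    (fun Lp Lm Mp Mm hLp hLm hL hMp hMm hM => by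
      convert mixed_shift_mid_powerset Lp Lm Mp Mm hLp hLm hL hMp hMm hM using 10)
    hE₀' Fp Fm Gp Gm hFp hFm hF hGp hGm hG
  simp only [Function.comp, hσ0, hσ1, hσ2] at h
  exact h

variable {q : Fin 6} {u w : ℕ → V} {a b : ℕ}
  (hu0 : u 0 = c 1) (hw0 : w 0 = c q)
  (hufresh : ∀ i, 0 < i → i ≤ a → ∀ f ∈ E₀ ∪ Cyc.edgeSet b w, u i ∈ f → f.IsDiag)
  (hwfresh : ∀ i, 0 < i → i ≤ b → ∀ f ∈ E₀, w i ∈ f → f.IsDiag)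
  (huinj : ∀ i j, i ≤ a → j ≤ a → u i = u j → i = j) (hwinj : ∀ i j, i ≤ b → j ≤ b → w i = w j → i = j)
  (hsu : ∀ i, 0 < i → i ≤ a → c 0 ≠ u i) (hsw : ∀ i, 0 < i → i ≤ b → c 0 ≠ w i)
  (hPw : ∀ i, 0 < i → i ≤ b → c 1 ≠ w i) (hzu : ∀ i, 0 < i → i ≤ a → w b ≠ u i)
include hu0 hw0 hufresh hwfresh huinj hwinj hsu hsw hPw hzu

/-- **THEOREM K24H (`K_{2,4}` + handle from a pole, all arm lengths).**  `K_{2,4}` on the poles `c 0 = s`, `c 1` and the middles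
`c 2, …, c 5` (`c` injective, image edge set `E₀`), a handle from `P = c 1` to `Q = c q` (ANY `q : Fin 6`; arms `u 0 = c 1, …, u a = y` and
`w 0 = c q, …, w b = z` of fresh vertices, `a, b ≥ 0`), `x` fresh joined to `y, z`, `yz ∉ H = E₀ ∪ arms`, `E = H + xy + xz`.  Then for all
monotone `F, G`: `0 ≤ Σ_{ω : ¬(x ∈ X_E ω ∧ x ∈ Y_E ω)} (F(X_E ω) − F(Y_E ω))·(G(X_E ω) − G(Y_E ω))`. [this work] -/
theorem handle_vertex_sum_nonneg {x : V}
    (hx : ∀ f ∈ (Cyc.edgeSet b w ∪ Cyc.edgeSet a u) ∪ E₀, x ∈ f → f.IsDiag)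
    (hxs : x ≠ c 0) (hxy : x ≠ u a) (hxz : x ≠ w b) (hyz : u a ≠ w b) (hg : s(u a, w b) ∉ (Cyc.edgeSet b w ∪ Cyc.edgeSet a u) ∪ E₀)
    {F G : Set V → ℝ} (hF : Monotone F) (hG : Monotone G) :
    0 ≤ ∑ ω ∈ Finset.univ.filter (fun ω : Set (Sym2 V) =>
        ¬ ((openGraph (ω ∩ insert s(x, u a) (insert s(x, w b) ((Cyc.edgeSet b w ∪ Cyc.edgeSet a u) ∪ E₀)))).Reachable (c 0) x ∧
          (openGraph (ωᶜ ∩ insert s(x, u a) (insert s(x, w b) ((Cyc.edgeSet b w ∪ Cyc.edgeSet a u) ∪ E₀)))).Reachable (c 0) x)),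
      (F (openCluster (ω ∩ insert s(x, u a) (insert s(x, w b) ((Cyc.edgeSet b w ∪ Cyc.edgeSet a u) ∪ E₀))) (c 0)) -
          F (openCluster (ωᶜ ∩ insert s(x, u a) (insert s(x, w b) ((Cyc.edgeSet b w ∪ Cyc.edgeSet a u) ∪ E₀))) (c 0))) *
        (G (openCluster (ω ∩ insert s(x, u a) (insert s(x, w b) ((Cyc.edgeSet b w ∪ Cyc.edgeSet a u) ∪ E₀))) (c 0)) -
          G (openCluster (ωᶜ ∩ insert s(x, u a) (insert s(x, w b) ((Cyc.edgeSet b w ∪ Cyc.edgeSet a u) ∪ E₀))) (c 0))) := by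
  -- (the edge set of `H` is written `(stub ∪ arm) ∪ E₀`; the shifted dual handle theorem writes `stub ∪ (arm ∪ E₀)`)
  have hassoc : (Cyc.edgeSet b w ∪ Cyc.edgeSet a u) ∪ E₀ = Cyc.edgeSet b w ∪ (Cyc.edgeSet a u ∪ E₀) := Set.union_assoc _ _ _
  rw [hassoc] at hx hg ⊢
  -- no loops in the image edge set
  have hK : ∀ e ∈ ({s(0, 2), s(1, 2), s(0, 3), s(1, 3), s(0, 4), s(1, 4), s(0, 5), s(1, 5)} : Finset (Sym2 (Fin 6))), ¬ e.IsDiag := by decide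
  have hnd : ∀ f ∈ E₀, ¬ f.IsDiag := by
    intro f hf
    rw [hE₀] at hf
    obtain ⟨e, he, rfl⟩ := hf
    have hne := hK e (Finset.mem_coe.1 he)
    induction e using Sym2.ind with
    | h i j =>
      rw [Sym2.map_mk, Sym2.mk_isDiag_iff]
      rw [Sym2.mk_isDiag_iff] at hne
      exact fun h => hne (hc h)
  have hop := fun (Fp Fm Gp Gm : Set V → ℝ) hFp hFm hF' hGp hGm hG' =>
    oplus_shift hc hE₀ Fp Fm Gp Gm hFp hFm hF' hGp hGm hG'
  have hmix := fun (Fp Fm Gp Gm : Set V → ℝ) hFp hFm hF' hGp hGm hG' =>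
    mixed_shift hc hE₀ q Fp Fm Gp Gm hFp hFm hF' hGp hGm hG'
  have h := Pendant.handle_vertex_sum_nonneg_of_oplus_shift hnd hwfresh hwinj hsw hPw hop hu0 hw0 hufresh huinj hsu hzu
    hmix hx hxs hxy hxz hyz hg hF hG
  convert h using 3

end K24

end Antithetic

end Summit.CriticalPhenomena.PercolationContinuityZ3.Theorems
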